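import Summits.AnomalousDissipation.AnomalousDissipation.Theorems.MarginalStabilityChainStrainedLayerLawStubExcessEnergyKinematicA
import Summits.AnomalousDissipation.AnomalousDissipation.Theorems.MarginalStabilityChainStrainedLayerLawStubExcessEnergyKinematicB
import HarnessLib

/-!
# Stub `stub_excessEnergyKinematic` of line `strain-work-sum-rule` (crux `MarginalStabilityChain.StrainedLayerLaw`,
# stmt-AnomalousDissipation-3007): the kinematic bound of the excess energy by the vorticity norms

Support file (`--supports stmt-AnomalousDissipation-3007`) proving the registered stub `stub_excessEnergyKinematic`
BY NAME with its registered signature: for one `C²` divergence-free slice `(u, v)`, `L`-periodic in `x`, with the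
shear far field `u → ±½`, `v → 0` (`y → ±∞`) and shear tails `SliceTails C k u v`, the excess planar energy
`E = ½∫∫(u² + v² − ¼)` over the period cell is bounded by the cell's vorticity norms `A ≥ ∫∫|ω|`, `Ω ≥ ∫∫ω²`,
`M₁ ≥ ∫∫|y||ω|`:

  `E ≤ ½[(L/2π)²Ω + A·M₁/L] + ½M₁`.

Pure slice kinematics (no dynamics). Proof: with the period mean `ū(y) = L⁻¹∫₀ᴸ u dx`,
`∫₀ᴸ u² = ∫₀ᴸ (u − ū)² + Lū²`; Wirtinger on the period (tool file A) for the fluctuation `u − ū` and for `v`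
(`∫₀ᴸ v dx ≡ 0`: its `y`-derivative is `∫₀ᴸ ∂_yv = −∫₀ᴸ ∂ₓu = 0` and it tends to `0`), so
`2E ≤ (L/2π)²∫∫(uₓ² + vₓ²) + L∫(ū² − ¼)`; `∫∫(uₓ² + vₓ²) ≤ ∫∫|∇(u,v)|² = ∫∫ω²` (tool file B); and
`ū′ = L⁻¹∫₀ᴸ ∂_yu = −L⁻¹∫₀ᴸ ω` with `ū → ±½`, so the shear-profile bound (tool file A, `φ = L⁻¹∫₀ᴸ|ω| dx`,
`∫φ ≤ A/L`, `∫|y|φ ≤ M₁/L`) gives `L∫(ū² − ¼) ≤ L(1 + A/L)(M₁/L) = M₁ + A·M₁/L`.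

References: worker memo `work/stubs/stub_excessEnergySublinear.md` §3 (d′) (lead's folder); A. J. Majda,
A. L. Bertozzi, *Vorticity and Incompressible Flow*, CUP 2002, §3.1.1 (energy method on the period strip);
G. H. Hardy, J. E. Littlewood, G. Pólya, *Inequalities*, CUP 1952, §7.7 (Wirtinger).
-/

-- `Summit.<Summit>.<Problem>` is the tree's mandated summit-side namespace (CONVENTIONS §2); for this
-- single-conjunct summit the two coincide, so the duplicate is deliberate.
set_option linter.dupNamespace false

noncomputable section

open scoped Topology ENNReal
open Filter Set Function MeasureTheory

namespace Summit.AnomalousDissipation.AnomalousDissipation.Theorems.StrainedLayerLaw.StrainWorkSumRule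

open Literature.Analysis.FluidPDE Literature.Analysis.FluidPDE.StretchedLayer

/-! ## Fubini bridges: iterated, strip and transverse-of-period integrals -/

/-- For a function integrable on the strip, the iterated integral `∫_{x ∈ (0,L]} ∫_y` is the strip integral
(private copy of `integral_iterated_eq_strip`). [folklore] -/
private theorem iterated_eq_strip {L : ℝ} {F : ℝ × ℝ → ℝ} (hF : IntegrableOn F (Ioc 0 L ×ˢ univ)) :
    ∫ x in Ioc 0 L, ∫ y, F (x, y) = ∫ q in Ioc 0 L ×ˢ univ, F q := by
  rw [IntegrableOn, volume_restrict_strip] at hF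
  rw [volume_restrict_strip, integral_prod _ hF]

/-- For a function integrable on the strip, the strip integral is `∫_y ∫₀ᴸ dx` (Fubini, the other order).
[folklore] -/
private theorem strip_eq_integral_intervalIntegral {L : ℝ} (hL : 0 ≤ L) {F : ℝ × ℝ → ℝ}
    (hF : IntegrableOn F (Ioc 0 L ×ˢ univ)) :
    ∫ q in Ioc 0 L ×ˢ univ, F q = ∫ y, ∫ x in (0:ℝ)..L, F (x, y) := by
  rw [IntegrableOn, volume_restrict_strip] at hF
  rw [volume_restrict_strip, integral_prod_symm _ hF]
  exact integral_congr_ae (Eventually.of_forall fun y => (intervalIntegral.integral_of_le hL).symm)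

/-- For a function integrable on the strip, `y ↦ ∫₀ᴸ F(x, y) dx` is integrable on `ℝ`. [folklore] -/
private theorem integrable_intervalIntegral_of_strip {L : ℝ} (hL : 0 ≤ L) {F : ℝ × ℝ → ℝ}
    (hF : IntegrableOn F (Ioc 0 L ×ˢ univ)) : Integrable fun y => ∫ x in (0:ℝ)..L, F (x, y) := by
  rw [IntegrableOn, volume_restrict_strip] at hF
  exact hF.integral_prod_right.congr
    (Eventually.of_forall fun y => (intervalIntegral.integral_of_le hL).symm)

/-! ## The stub -/

/-- **Registered stub `stub_excessEnergyKinematic` of the line `strain-work-sum-rule` (crux `StrainedLayerLaw`,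
stmt-AnomalousDissipation-3007): the kinematic bound of the excess planar energy of a shear-layer slice by its
vorticity norms.** For a `C²` divergence-free slice `(u, v)`, `L`-periodic in `x` (`L > 0`), with the shear far
field and shear tails `SliceTails C k u v` (`k > 0`): if `∫∫|ω| ≤ A`, `∫∫ω² ≤ Ω`, `∫∫|y||ω| ≤ M₁` over the period
cell (`ω = ∂ₓv − ∂_yu`), then `excessEnergy L u v ≤ ((L/2π)²Ω + A·M₁/L)/2 + M₁/2`. Period-mean split
`∫₀ᴸu² = ∫₀ᴸ(u − ū)² + Lū²`, Wirtinger for `u − ū` and for `v` (zero period mean), `∫∫(uₓ² + vₓ²) ≤ ∫∫ω²`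
(enstrophy = Dirichlet integral), and the shear-profile bound for `ū` (`ū′ = −L⁻¹∫₀ᴸω`, `ū → ±½`).
[folklore] -/
theorem stub_excessEnergyKinematic : ∀ (L C k : ℝ), 0 < L → 0 < k → ∀ (u v : ℝ → ℝ → ℝ),
    ContDiff ℝ 2 (fun q : ℝ × ℝ => u q.1 q.2) → ContDiff ℝ 2 (fun q : ℝ × ℝ => v q.1 q.2) →
    (∀ x y, dX u x y + dY v x y = 0) →
    (∀ x y, u (x + L) y = u x y) → (∀ x y, v (x + L) y = v x y) →
    (∀ x, Tendsto (fun y => u x y) atTop (𝓝 (1 / 2))) →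
    (∀ x, Tendsto (fun y => u x y) atBot (𝓝 (-(1 / 2)))) →
    (∀ x, Tendsto (fun y => v x y) atTop (𝓝 0)) →
    (∀ x, Tendsto (fun y => v x y) atBot (𝓝 0)) →
    SliceTails C k u v →
    ∀ (A Ω M₁ : ℝ),
      (∫ x in Ioc 0 L, ∫ y, |vorticity u v x y|) ≤ A →
      (∫ x in Ioc 0 L, ∫ y, vorticity u v x y ^ 2) ≤ Ω →
      (∫ x in Ioc 0 L, ∫ y, |y| * |vorticity u v x y|) ≤ M₁ →
        excessEnergy L u v ≤ ((L / (2 * Real.pi)) ^ 2 * Ω + A * M₁ / L) / 2 + M₁ / 2 := by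
  intro L C k hL hk u v hu hv hdiv hpu hpv hut hub _hvt _hvb hT A Ω M₁ hA hΩ hM
  have hS : MeasurableSet (Ioc (0:ℝ) L ×ˢ (univ : Set ℝ)) := measurableSet_Ioc.prod MeasurableSet.univ
  have hC : 0 ≤ C := hT.nonneg
  have hL0 : L ≠ 0 := hL.ne'
  -- regularity
  have hu1 : ContDiff ℝ 1 (fun q : ℝ × ℝ => u q.1 q.2) := hu.of_le one_le_two
  have hv1 : ContDiff ℝ 1 (fun q : ℝ × ℝ => v q.1 q.2) := hv.of_le one_le_two
  have hω1 := contDiff_one_vorticity hu hv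
  have cu : Continuous (fun q : ℝ × ℝ => u q.1 q.2) := hu.continuous
  have cv : Continuous (fun q : ℝ × ℝ => v q.1 q.2) := hv.continuous
  have cω : Continuous (fun q : ℝ × ℝ => vorticity u v q.1 q.2) := hω1.continuous
  have cux := continuous_dX hu1
  have cvx := continuous_dX hv1
  have dux : ∀ x y, HasDerivAt (fun s => u s y) (dX u x y) x := hasDerivAt_dX_of_contDiff hu two_ne_zero
  have dvx : ∀ x y, HasDerivAt (fun s => v s y) (dX v x y) x := hasDerivAt_dX_of_contDiff hv two_ne_zero
  -- the vorticity tail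
  have hωe : ∀ x y, |vorticity u v x y| ≤ C * Real.exp (-k * |y|) := fun x y => by
    have h := (hT x y).2.2.1
    calc |vorticity u v x y| = |dX v x y - dY u x y| := rfl
      _ ≤ |dX v x y| + |dY u x y| := abs_sub _ _
      _ ≤ C * Real.exp (-k * |y|) := by linarith [abs_nonneg (dX u x y), abs_nonneg (dY v x y)]
  -- integrability on the strip
  have iE : IntegrableOn (fun q : ℝ × ℝ => (u q.1 q.2 ^ 2 + v q.1 q.2 ^ 2 - 1 / 4) / 2) (Ioc 0 L ×ˢ univ) :=
    integrableOn_strip_of_abs_le_exp (contDiff_energyDensity hu hv).continuous (by positivity : 0 ≤ C / 2) hk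
      fun x _ y => hT.abs_energyDensity_le x y
  have iωa : IntegrableOn (fun q : ℝ × ℝ => |vorticity u v q.1 q.2|) (Ioc 0 L ×ˢ univ) :=
    integrableOn_strip_of_abs_le_exp cω.abs hC hk fun x _ y => by rw [abs_abs]; exact hωe x y
  have iωm : IntegrableOn (fun q : ℝ × ℝ => |q.2| * |vorticity u v q.1 q.2|) (Ioc 0 L ×ˢ univ) :=
    integrableOn_strip_of_abs_le_sq_exp (continuous_snd.abs.mul cω.abs) hk fun x _ y => by
      rw [abs_mul, abs_abs, abs_abs]
      calc |y| * |vorticity u v x y| ≤ |y| * (C * Real.exp (-k * |y|)) :=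
            mul_le_mul_of_nonneg_left (hωe x y) (abs_nonneg _)
        _ = C * (|y| * Real.exp (-k * |y|)) := by ring
        _ ≤ C * ((1 + |y|) ^ 2 * Real.exp (-k * |y|)) :=
            mul_le_mul_of_nonneg_left (abs_mul_exp_le_one_add_abs_sq_mul_exp k y) hC
  obtain ⟨iω2, iG, hGω⟩ := stub_excessEnergyKinematic_enstrophy L C k hL hk u v hu hv hdiv hpu hpv hT
  have iX : IntegrableOn (fun q : ℝ × ℝ => dX u q.1 q.2 ^ 2 + dX v q.1 q.2 ^ 2) (Ioc 0 L ×ˢ univ) :=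
    integrableOn_strip_of_abs_le_exp ((cux.pow 2).add (cvx.pow 2)) (sq_nonneg C) hk fun x _ y => by
      have h := hT.abs_gradSq_le hk x y
      rw [abs_of_nonneg (by positivity)] at h ⊢
      nlinarith [sq_nonneg (dY u x y), sq_nonneg (dY v x y)]
  -- the hypotheses as strip integrals; signs of the constants
  rw [show (∫ x in Ioc 0 L, ∫ y, |vorticity u v x y|) = ∫ q in Ioc 0 L ×ˢ univ, |vorticity u v q.1 q.2|
    from iterated_eq_strip iωa] at hA
  rw [show (∫ x in Ioc 0 L, ∫ y, vorticity u v x y ^ 2) = ∫ q in Ioc 0 L ×ˢ univ, vorticity u v q.1 q.2 ^ 2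
    from iterated_eq_strip iω2] at hΩ
  rw [show (∫ x in Ioc 0 L, ∫ y, |y| * |vorticity u v x y|) =
    ∫ q in Ioc 0 L ×ˢ univ, |q.2| * |vorticity u v q.1 q.2| from iterated_eq_strip iωm] at hM
  have hA0 : 0 ≤ A := (setIntegral_nonneg hS fun q _ => abs_nonneg _).trans hA
  have hM0 : 0 ≤ M₁ := (setIntegral_nonneg hS fun q _ => mul_nonneg (abs_nonneg _) (abs_nonneg _)).trans hM
  -- period integrals of `∂ₓu`, `∂ₓv`, `v`
  have hxu : ∀ y, ∫ x in (0:ℝ)..L, dX u x y = 0 := intervalIntegral_dX_period_eq_zero hu1 hpu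
  have hxv : ∀ y, ∫ x in (0:ℝ)..L, dX v x y = 0 := intervalIntegral_dX_period_eq_zero hv1 hpv
  have hV0 : ∀ y, ∫ x in (0:ℝ)..L, v x y = 0 := by
    have hV' : ∀ y, HasDerivAt (fun t => ∫ x in (0:ℝ)..L, v x t) 0 y := by
      intro y
      refine (hasDerivAt_intervalIntegral_dY hv1 0 L y).congr_deriv ?_
      have e : ∀ x, dY v x y = -dX u x y := fun x => by linarith [hdiv x y]
      simp_rw [e]
      rw [intervalIntegral.integral_neg, hxu y, neg_zero]
    have hconst : ∀ y y', (∫ x in (0:ℝ)..L, v x y) = ∫ x in (0:ℝ)..L, v x y' :=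
      is_const_of_deriv_eq_zero (fun y => (hV' y).differentiableAt) fun y => (hV' y).deriv
    have hbdV : ∀ y, |∫ x in (0:ℝ)..L, v x y| ≤ L * C * Real.exp (-k * |y|) := by
      intro y
      have h := intervalIntegral.norm_integral_le_of_norm_le_const (a := 0) (b := L) (f := fun x => v x y)
        (C := C * Real.exp (-k * |y|)) fun x _ => by rw [Real.norm_eq_abs]; exact hT.abs_v_le x y
      rw [Real.norm_eq_abs, sub_zero, abs_of_pos hL] at h
      linarith
    have hlim : Tendsto (fun y => ∫ x in (0:ℝ)..L, v x y) atTop (𝓝 0) :=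
      tendsto_zero_atTop_of_abs_le_exp hk hbdV
    intro y
    exact tendsto_nhds_unique tendsto_const_nhds (hlim.congr fun y' => hconst y' y)
  -- the period mean `ū = L⁻¹ U` and its derivative `−L⁻¹ ∫₀ᴸ ω`
  set U : ℝ → ℝ := fun y => ∫ x in (0:ℝ)..L, u x y with hUdef
  have hU' : ∀ y, HasDerivAt U (-∫ x in (0:ℝ)..L, vorticity u v x y) y := by
    intro y
    refine (hasDerivAt_intervalIntegral_dY hu1 0 L y).congr_deriv ?_
    have e : ∀ x, dY u x y = dX v x y - vorticity u v x y := fun x => by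
      show dY u x y = dX v x y - (dX v x y - dY u x y); ring
    simp_rw [e]
    rw [intervalIntegral.integral_sub ((continuous_slice_x cvx y).intervalIntegrable _ _)
      ((continuous_slice_x cω y).intervalIntegrable _ _), hxv y, zero_sub]
  -- `U → ±L/2`
  have hUdev : ∀ y, |U y - L * u 0 y| ≤ L * (L * C) * Real.exp (-k * |y|) := by
    intro y
    have hdiff : Differentiable ℝ (fun s => u s y) := fun s => (dux s y).differentiableAt
    have hpt : ∀ x ∈ Set.uIoc (0:ℝ) L, ‖u x y - u 0 y‖ ≤ L * C * Real.exp (-k * |y|) := by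
      intro x hx
      rw [uIoc_of_le hL.le] at hx
      have h := abs_sub_shift_le hdiff hx.1.le (fun s => hT.abs_dX_u_le s y) 0
      rw [zero_add] at h
      rw [Real.norm_eq_abs]
      calc |u x y - u 0 y| ≤ C * Real.exp (-k * |y|) * x := h
        _ ≤ C * Real.exp (-k * |y|) * L := mul_le_mul_of_nonneg_left hx.2 (by positivity)
        _ = L * C * Real.exp (-k * |y|) := by ring
    have h := intervalIntegral.norm_integral_le_of_norm_le_const hpt
    rw [intervalIntegral.integral_sub ((continuous_slice_x cu y).intervalIntegrable _ _) intervalIntegrable_const,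
      intervalIntegral.integral_const, sub_zero, smul_eq_mul, Real.norm_eq_abs, abs_of_pos hL] at h
    calc |U y - L * u 0 y| ≤ L * C * Real.exp (-k * |y|) * L := h
      _ = L * (L * C) * Real.exp (-k * |y|) := by ring
  have hUtop : Tendsto U atTop (𝓝 (L * (1 / 2))) := by
    have h1 : Tendsto (fun y => U y - L * u 0 y) atTop (𝓝 0) := tendsto_zero_atTop_of_abs_le_exp hk hUdev
    have h2 : Tendsto (fun y => L * u 0 y) atTop (𝓝 (L * (1 / 2))) := (hut 0).const_mul L
    have h3 := h1.add h2
    rw [zero_add] at h3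
    exact h3.congr fun y => by ring
  have hUbot : Tendsto U atBot (𝓝 (L * -(1 / 2))) := by
    have h1 : Tendsto (fun y => U y - L * u 0 y) atBot (𝓝 0) := tendsto_zero_atBot_of_abs_le_exp hk hUdev
    have h2 : Tendsto (fun y => L * u 0 y) atBot (𝓝 (L * -(1 / 2))) := (hub 0).const_mul L
    have h3 := h1.add h2
    rw [zero_add] at h3
    exact h3.congr fun y => by ring
  -- the shear-profile bound for `ū`
  set φ : ℝ → ℝ := fun y => L⁻¹ * ∫ x in (0:ℝ)..L, |vorticity u v x y| with hφdef
  have hφW : ∫ y, φ y = L⁻¹ * ∫ q in Ioc 0 L ×ˢ univ, |vorticity u v q.1 q.2| := by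
    rw [strip_eq_integral_intervalIntegral hL.le iωa, ← integral_const_mul]
  have hφM : ∫ y, |y| * φ y = L⁻¹ * ∫ q in Ioc 0 L ×ˢ univ, |q.2| * |vorticity u v q.1 q.2| := by
    rw [strip_eq_integral_intervalIntegral hL.le iωm, ← integral_const_mul]
    refine integral_congr_ae (Eventually.of_forall fun y => ?_)
    show |y| * (L⁻¹ * ∫ x in (0:ℝ)..L, |vorticity u v x y|) = L⁻¹ * ∫ x in (0:ℝ)..L, |y| * |vorticity u v x y|
    rw [intervalIntegral.integral_const_mul]; ring
  have hφi : Integrable φ := (integrable_intervalIntegral_of_strip hL.le iωa).const_mul L⁻¹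
  have hφm : Integrable fun y => |y| * φ y := by
    refine ((integrable_intervalIntegral_of_strip hL.le iωm).const_mul L⁻¹).congr
      (Eventually.of_forall fun y => ?_)
    show L⁻¹ * (∫ x in (0:ℝ)..L, |y| * |vorticity u v x y|) = |y| * (L⁻¹ * ∫ x in (0:ℝ)..L, |vorticity u v x y|)
    rw [intervalIntegral.integral_const_mul]; ring
  obtain ⟨iP, hP⟩ := shearProfile_bound (g := fun y => L⁻¹ * U y)
    (g' := fun y => L⁻¹ * -∫ x in (0:ℝ)..L, vorticity u v x y) (φ := φ)
    (fun y => (hU' y).const_mul L⁻¹)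
    (((continuous_intervalIntegral_sliceY cω 0 L).neg).const_mul L⁻¹)
    ((continuous_intervalIntegral_sliceY cω.abs 0 L).const_mul L⁻¹)
    (fun y => by
      show |L⁻¹ * -∫ x in (0:ℝ)..L, vorticity u v x y| ≤ L⁻¹ * ∫ x in (0:ℝ)..L, |vorticity u v x y|
      rw [abs_mul, abs_neg, abs_of_pos (inv_pos.2 hL)]
      exact mul_le_mul_of_nonneg_left (intervalIntegral.abs_integral_le_integral_abs hL.le)
        (inv_pos.2 hL).le)
    hφi hφm
    (by have h := hUtop.const_mul L⁻¹; rwa [← mul_assoc, inv_mul_cancel₀ hL0, one_mul] at h)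
    (by have h := hUbot.const_mul L⁻¹; rwa [← mul_assoc, inv_mul_cancel₀ hL0, one_mul] at h)
  have hPb : ∫ y, ((L⁻¹ * U y) ^ 2 - 1 / 4) ≤ (1 + A / L) * (M₁ / L) := by
    refine hP.trans (mul_le_mul ?_ ?_ (integral_nonneg fun y => mul_nonneg (abs_nonneg _) ?_) (by positivity))
    · rw [hφW, div_eq_inv_mul]
      exact add_le_add le_rfl (mul_le_mul_of_nonneg_left hA (inv_pos.2 hL).le)
    · rw [hφM, div_eq_inv_mul]
      exact mul_le_mul_of_nonneg_left hM (inv_pos.2 hL).le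
    · exact mul_nonneg (inv_pos.2 hL).le (intervalIntegral.integral_nonneg hL.le fun x _ => abs_nonneg _)
  -- the per-`y` bound: Wirtinger for the fluctuation and for `v`, and the period-mean split
  have hrow : ∀ y, ∫ x in (0:ℝ)..L, (u x y ^ 2 + v x y ^ 2 - 1 / 4) / 2 ≤
      ((L / (2 * Real.pi)) ^ 2 * (∫ x in (0:ℝ)..L, (dX u x y ^ 2 + dX v x y ^ 2)) +
        L * ((L⁻¹ * U y) ^ 2 - 1 / 4)) / 2 := by
    intro y
    set c : ℝ := L⁻¹ * U y with hc
    have iu : IntervalIntegrable (fun x => u x y) volume 0 L := (continuous_slice_x cu y).intervalIntegrable 0 L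
    have iv2 : IntervalIntegrable (fun x => v x y ^ 2) volume 0 L :=
      ((continuous_slice_x cv y).pow 2).intervalIntegrable 0 L
    have iu2 : IntervalIntegrable (fun x => u x y ^ 2) volume 0 L :=
      ((continuous_slice_x cu y).pow 2).intervalIntegrable 0 L
    have iux2 : IntervalIntegrable (fun x => dX u x y ^ 2) volume 0 L :=
      ((continuous_slice_x cux y).pow 2).intervalIntegrable 0 L
    have ivx2 : IntervalIntegrable (fun x => dX v x y ^ 2) volume 0 L :=
      ((continuous_slice_x cvx y).pow 2).intervalIntegrable 0 L
    -- Wirtinger for `u − c` and for `v`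
    have hWu := stub_excessEnergyKinematic_wirtinger L (fun x => u x y - c) (fun x => dX u x y) hL
      (fun x => (dux x y).sub_const c) (continuous_slice_x cux y)
      (by show u L y - c = u 0 y - c; rw [show u L y = u 0 y by simpa using hpu 0 y])
      (by rw [intervalIntegral.integral_sub iu intervalIntegrable_const, intervalIntegral.integral_const,
            sub_zero, smul_eq_mul, hc, ← mul_assoc, mul_inv_cancel₀ hL0, one_mul, sub_self])
    have hWv := stub_excessEnergyKinematic_wirtinger L (fun x => v x y) (fun x => dX v x y) hL
      (fun x => dvx x y) (continuous_slice_x cvx y) (by simpa using hpv 0 y) (hV0 y)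
    -- the period-mean split `∫u² = ∫(u − c)² + Lc²`
    have hsplit : ∫ x in (0:ℝ)..L, (u x y - c) ^ 2 = (∫ x in (0:ℝ)..L, u x y ^ 2) - L * c ^ 2 := by
      have e : ∀ x, (u x y - c) ^ 2 = u x y ^ 2 - (2 * c) * u x y + c ^ 2 := fun x => by ring
      simp_rw [e]
      rw [intervalIntegral.integral_add (iu2.sub (iu.const_mul _)) intervalIntegrable_const,
        intervalIntegral.integral_sub iu2 (iu.const_mul _), intervalIntegral.integral_const_mul,
        intervalIntegral.integral_const, sub_zero, smul_eq_mul]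
      have hUc : ∫ x in (0:ℝ)..L, u x y = L * c := by
        rw [hc, ← mul_assoc, mul_inv_cancel₀ hL0, one_mul]
      rw [hUc]
      ring
    have he : ∫ x in (0:ℝ)..L, (u x y ^ 2 + v x y ^ 2 - 1 / 4) / 2 =
        ((∫ x in (0:ℝ)..L, u x y ^ 2) + (∫ x in (0:ℝ)..L, v x y ^ 2) - L * (1 / 4)) / 2 := by
      rw [intervalIntegral.integral_div, intervalIntegral.integral_sub (iu2.add iv2) intervalIntegrable_const,
        intervalIntegral.integral_add iu2 iv2, intervalIntegral.integral_const, sub_zero, smul_eq_mul]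
    have hX : ∫ x in (0:ℝ)..L, (dX u x y ^ 2 + dX v x y ^ 2) =
        (∫ x in (0:ℝ)..L, dX u x y ^ 2) + ∫ x in (0:ℝ)..L, dX v x y ^ 2 :=
      intervalIntegral.integral_add iux2 ivx2
    rw [he, hX]
    linarith [hWu, hWv, hsplit]
  -- integrate the per-`y` bound
  have iPy : Integrable fun y => ∫ x in (0:ℝ)..L, (u x y ^ 2 + v x y ^ 2 - 1 / 4) / 2 :=
    integrable_intervalIntegral_of_strip hL.le iE
  have iXy : Integrable fun y => ∫ x in (0:ℝ)..L, (dX u x y ^ 2 + dX v x y ^ 2) :=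
    integrable_intervalIntegral_of_strip hL.le iX
  have hE : excessEnergy L u v = ∫ y, ∫ x in (0:ℝ)..L, (u x y ^ 2 + v x y ^ 2 - 1 / 4) / 2 := by
    rw [← strip_eq_integral_intervalIntegral hL.le iE, ← iterated_eq_strip iE]
    rfl
  have hXΩ : ∫ y, ∫ x in (0:ℝ)..L, (dX u x y ^ 2 + dX v x y ^ 2) ≤ Ω := by
    rw [← strip_eq_integral_intervalIntegral hL.le iX]
    refine le_trans ?_ (hGω.le.trans hΩ)
    exact integral_mono iX iG fun q => by
      show dX u q.1 q.2 ^ 2 + dX v q.1 q.2 ^ 2 ≤ _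
      nlinarith [sq_nonneg (dY u q.1 q.2), sq_nonneg (dY v q.1 q.2)]
  have hint : ∫ y, ∫ x in (0:ℝ)..L, (u x y ^ 2 + v x y ^ 2 - 1 / 4) / 2 ≤
      ((L / (2 * Real.pi)) ^ 2 * (∫ y, ∫ x in (0:ℝ)..L, (dX u x y ^ 2 + dX v x y ^ 2)) +
        L * ∫ y, ((L⁻¹ * U y) ^ 2 - 1 / 4)) / 2 := by
    rw [← integral_const_mul, ← integral_const_mul, ← integral_add (iXy.const_mul _) (iP.const_mul _),
      ← integral_div]
    exact integral_mono iPy (((iXy.const_mul _).add (iP.const_mul _)).div_const _) hrow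
  rw [hE]
  refine hint.trans ?_
  have h1 : (L / (2 * Real.pi)) ^ 2 * (∫ y, ∫ x in (0:ℝ)..L, (dX u x y ^ 2 + dX v x y ^ 2)) ≤
      (L / (2 * Real.pi)) ^ 2 * Ω := mul_le_mul_of_nonneg_left hXΩ (sq_nonneg _)
  have h2 : L * ∫ y, ((L⁻¹ * U y) ^ 2 - 1 / 4) ≤ L * ((1 + A / L) * (M₁ / L)) :=
    mul_le_mul_of_nonneg_left hPb hL.le
  have h3 : L * ((1 + A / L) * (M₁ / L)) = M₁ + A * M₁ / L := by
    field_simp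
  linarith [h1, h2, h3]

end Summit.AnomalousDissipation.AnomalousDissipation.Theorems.StrainedLayerLaw.StrainWorkSumRule

end
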